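import Mathlib
import Literature.NumberTheory.LFunctions.PrimeCountingAbel
import Literature.NumberTheory.Sieve.RomanoffExplicitAllN
import Literature.NumberTheory.Sieve.RomanoffExplicitAllN34
import Literature.NumberTheory.Sieve.RomanoffExplicitAllN40
import HarnessLib

/-!
# Romanoff's theorem, explicit and uniform in `N`: `#{n ≤ N : n = p + 2^k} ≥ N/31` for every `N ≥ 4`

Fourth module of the explicit all-`N` Romanov bound (`RomanoffExplicitAllN.lean`: `1/79`, `1/45`;
`RomanoffExplicitAllN40.lean`: `1/40` and `N/31` from `e^{38}`; `RomanoffExplicitAllN34.lean`: `1/34` and `N/34` from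
`e^{32}`, with the pair sieve `pairCount_le_1435 = UniformPairSieve 14.35 e^{32}`).  That architecture met its wall on
both sides with the Chebyshev-shape input `c₀ = 0.9636` (`primeCountingLowerMul_09636`): density `0.02984` above
`e^{32}`, junction `0.9636·34 = 32.76 ≥ 32` below.  NEW INPUT: `PrimeCountingAbel.lean` (`n/log n ≤ π(n)` for
`17 ≤ n ≤ e^{60}`, and `1.003·x/log x ≤ π(⌊x⌋)` on `[e^{31}, e^{32}]`), which lifts both sides to `1/32`:
* §2 a WINDOWED first-moment engine `M1_ge_mul_window` / `density_mul_window` — the tree's `M1_ge_mul` /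
  `density_mul_param30` with the global `PrimeCountingLowerMul c₀ x₁` replaced by `c₀ n/log n ≤ π(n)` for
  `x₁ ≤ n ≤ N` only (the shifts `N − 2^k` never leave `[0, N]`);
* §3 `romanov_ge_div32_window` (`e^{32} ≤ N ≤ e^{60}`: `c₀ = 1`, `A = 14.35`, `s = 1.3797`,
  `1.3797²/(1.3797 + 4.035·14.35) = 0.03211 ≥ 1/32`), `romanov_ge_div31_window` (`[e^{34}, e^{60}]`, `s = 1.3831`,
  `0.032267 ≥ 1/31`), hence with the tree's `romanov_ge_div31` (`N ≥ e^{38}`): `romanov_ge_div32_from_exp32` and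
  `romanov_ge_div31_from_exp34` (tree threshold for `1/31`: `e^{38}` ↦ `e^{34}`), unconditional;
* §4 below `e^{32}` one shift `p + 2`: `π(N − 2) ≥ (N − 2)/log(N − 2) ≥ N/32` for `log(N − 2) ≤ 31` (`N ≥ 64`), the
  `1.003` junction regime on the last unit of `log` (`1.003 (N − 2) ≥ N` iff `N ≥ 669`), and four kernel checkpoints
  `π(2), π(30), π(318), π(2110) ≥ 1, 10, 66, 317` for `4 ≤ N < 5395`;
* §5 ★ `romanoffAllN_32 : RomanoffAllN (1/32) 4`, zero named facts; `primeCountingLowerMul_09844` restates the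
  global constant of `PrimeCountingAbel` in this file's vocabulary;
* part S (§S2–§S6): TWO shifts `p + 2`, `p + 4` — `#romanovSet N ≥ π(N − 2) + π(N − 4) − twinLE (N − 4)` with the twin
  count bounded by `pairCount_le_1435` (at `⌈e^{32}⌉` below `e^{32}`), plus the Abel regimes `1.003`/`1.008` on
  `(e^{30}, e^{31.2}]`: ★★ `romanoffAllN_31 : RomanoffAllN (1/31) 4` (the all-`N` constant equals the tree's large-range
  `romanov_ge_div31`), and `romanov_ge_div29_from_exp38` (`N/29` for `N ≥ e^{38}`; `c₀ = 1` window / `0.9844` global).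
With ONE shift the junction caps the all-`N` constant at `1/32` (`π(N − 2) ≥ N/31` up to `e^{34}` would need
`π(x) ≥ 1.097 x/log x`); part S's second shift lifts it to `1/31`, where one-shift reach (`log ≤ 31.2`, `C = 1.008`) and
two-shift reach (from `log = 31.2`, paying `e^{0.8}` for the sieve threshold `e^{32}`) meet with `0.7 %` to spare;
`1/30` would need a pair sieve from `≈ e^{30}` (the `c = 2` cell floor is `2^{46} = e^{31.88}`).
NOT a new asymptotic Romanov constant (print, `N ≥ N₀` only: Chen–Sun 2004 `0.0868`, Habsieger–Roblot 2006 `0.0933`,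
Pintz 2006 `0.09368`, Elsholtz–Schlage-Puchta 2018 `0.107648`) and NOT a parity statement.
Origin: research cell parity-ideate (seat p5, ROUND-47 «ABEL», 2026-08-29); statements and proofs kernel-checked there
verbatim (`Romanoff32.lean`).
-/

namespace Literature.NumberTheory.Sieve.RomanoffExplicit

open Finset
open Literature.NumberTheory.Sieve
open Literature.NumberTheory.Sieve.RomanoffExplicit
open Literature.NumberTheory.Sieve.Romanov (romanovSet)
open Literature.NumberTheory.LFunctions.PrimeCountingAbel (smallPrimes le_primeCounting_of_le_exp60
  le_primeCounting_floor_junction le_primeCounting_floor_reg30 le_primeCounting_floor_reg31 primeCounting_ge_09844)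

/-! ## §1 Private copies of tree lemmas (`RomanoffExplicitAllN.lean`, private there) -/

/-- Concavity of `log`: `log₂ u ≤ 2 − 2/u` on `[1, 2]`. [folklore] -/
private lemma log_le_chord {u : ℝ} (h1 : 1 ≤ u) (h2 : u ≤ 2) : Real.log u ≤ (2 - 2 / u) * Real.log 2 := by
  have hu : 0 < u := by linarith
  have hconc := (strictConcaveOn_log_Ioi).concaveOn
  have hw1 : 1 / 2 ≤ 1 / u := by
    rw [div_le_div_iff₀ (by norm_num) hu]; linarith
  have hw2 : 1 / u ≤ 1 := by
    rw [div_le_one hu]; exact h1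
  have key := hconc.2 (show (1 / 2 : ℝ) ∈ Set.Ioi (0 : ℝ) by norm_num) (show (1 : ℝ) ∈ Set.Ioi (0 : ℝ) by norm_num)
    (show (0 : ℝ) ≤ 2 - 2 * (1 / u) by linarith) (show (0 : ℝ) ≤ 2 * (1 / u) - 1 by linarith)
    (show (2 - 2 * (1 / u)) + (2 * (1 / u) - 1) = (1 : ℝ) by ring)
  simp only [smul_eq_mul, Real.log_one, mul_zero, add_zero, mul_one] at key
  have e0 : (2 - 2 * (1 / u)) * (1 / 2) + (2 * (1 / u) - 1) = 1 / u := by ring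
  rw [e0] at key
  have e1 : Real.log (1 / 2) = -Real.log 2 := by rw [one_div, Real.log_inv]
  have e2 : Real.log (1 / u) = -Real.log u := by rw [one_div, Real.log_inv]
  rw [e1, e2] at key
  have e3 : (2 - 2 / u) = 2 - 2 * (1 / u) := by ring
  rw [e3]
  linarith

/-- The floor-log correction: `K·N − 2·2^K ≥ N (log N/log 2 − 2)` for `K = log₂ N`, `N ≥ 1`. [folklore] -/
private lemma natlog_main (N : ℕ) (hN : 1 ≤ N) :
    (N : ℝ) * (Real.log (N : ℝ) / Real.log 2 - 2) ≤ (Nat.log 2 N : ℝ) * N - 2 * (2 : ℝ) ^ (Nat.log 2 N) := by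
  set K := Nat.log 2 N with hK
  have hlog2 : 0 < Real.log 2 := Real.log_pos one_lt_two
  have hpow : (0 : ℝ) < (2 : ℝ) ^ K := by positivity
  have hlo : (2 : ℝ) ^ K ≤ (N : ℝ) := by exact_mod_cast Nat.pow_log_le_self 2 (by omega)
  have hhi : (N : ℝ) ≤ 2 * (2 : ℝ) ^ K := by
    have := Nat.lt_pow_succ_log_self (b := 2) (by norm_num) N
    rw [pow_succ] at this
    have : (N : ℝ) < (2 : ℝ) ^ K * 2 := by exact_mod_cast this
    linarith
  set u := (N : ℝ) / (2 : ℝ) ^ K with hu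
  have hu1 : 1 ≤ u := by rw [hu, le_div_iff₀ hpow]; linarith
  have hu2 : u ≤ 2 := by rw [hu, div_le_iff₀ hpow]; linarith
  have hupos : 0 < u := by linarith
  have hchord := log_le_chord hu1 hu2
  have hlogN : Real.log (N : ℝ) = (K : ℝ) * Real.log 2 + Real.log u := by
    have hNpos : (0 : ℝ) < N := by exact_mod_cast (show 0 < N by omega)
    rw [hu, Real.log_div hNpos.ne' hpow.ne', Real.log_pow]; ring
  have hNpos : (0 : ℝ) < N := by exact_mod_cast (show 0 < N by omega)
  have h2u : 2 / u * (N : ℝ) = 2 * (2 : ℝ) ^ K := by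
    rw [hu]; field_simp
  have h3 : Real.log (N : ℝ) / Real.log 2 - 2 ≤ (K : ℝ) - 2 / u := by
    rw [hlogN, add_div, mul_div_assoc, div_self hlog2.ne', mul_one]
    have : Real.log u / Real.log 2 ≤ 2 - 2 / u := by rw [div_le_iff₀ hlog2]; exact hchord
    linarith
  calc (N : ℝ) * (Real.log (N : ℝ) / Real.log 2 - 2) ≤ (N : ℝ) * ((K : ℝ) - 2 / u) :=
        mul_le_mul_of_nonneg_left h3 hNpos.le
    _ = (K : ℝ) * N - 2 / u * (N : ℝ) := by ring
    _ = (K : ℝ) * N - 2 * (2 : ℝ) ^ K := by rw [h2u]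

/-- `∑_{k=1}^{K} 2^k = 2^{K+1} − 2`. [folklore] -/
private lemma sum_two_pow_Icc (K : ℕ) : ∑ k ∈ Icc 1 K, (2 : ℝ) ^ k = 2 * (2 : ℝ) ^ K - 2 := by
  induction K with
  | zero => simp
  | succ K ih => rw [Finset.sum_Icc_succ_top (by omega), ih, pow_succ]; ring

/-- `π(N − 2) ≤ #romanovSet N` (the shift `p + 2`; private copy). [folklore] -/
private theorem primeCounting_le_card_romanovSet (N : ℕ) :
    Nat.primeCounting (N - 2) ≤ (romanovSet N).card := by
  classical
  rw [← Nat.primesLE_card_eq_primeCounting]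
  refine card_le_card_of_injOn (fun p => p + 2) ?_ ?_
  · intro p hp
    rw [mem_coe, Nat.mem_primesLE] at hp
    have h2 := hp.2.two_le
    simp only [mem_coe, Romanov.romanovSet, mem_filter, mem_range]
    exact ⟨by omega, p, 1, hp.2, le_rfl, by ring⟩
  · intro p _ q _ h
    simpa using h

/-! ## §2 The window first-moment engine -/

/-- **First moment from a Chebyshev-shape bound valid on a window**: if `c₀ n/log n ≤ π(n)` for `x₁ ≤ n ≤ N`
(`x₁ ≥ 3`, `c₀ ≥ 0`, `N ≥ 2x₁`), then `S₁(N)·log N ≥ c₀·(N (log N/log 2 − 2) − x₁)` — the shifts `N − 2^k` never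
leave `[0, N]`, so only the window is needed.
[cite: Nathanson1996, §7.6 Lemma 7.10 (first moment; explicit windowed form proved here)] -/
theorem M1_ge_mul_window {c₀ : ℝ} {x₁ : ℕ} (hc₀ : 0 ≤ c₀) (hx₁ : 3 ≤ x₁) {N : ℕ}
    (hπ : ∀ n : ℕ, x₁ ≤ n → n ≤ N → c₀ * (n : ℝ) / Real.log (n : ℝ) ≤ (Nat.primeCounting n : ℝ))
    (hN : 2 * x₁ ≤ N) :
    c₀ * ((N : ℝ) * (Real.log (N : ℝ) / Real.log 2 - 2) - x₁) ≤ M1 N * Real.log (N : ℝ) := by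
  set K := Nat.log 2 N with hK
  set L := Real.log (N : ℝ) with hL
  have hNpos : (0 : ℝ) < N := by exact_mod_cast (show 0 < N by omega)
  have hK1 : 1 ≤ K := Nat.le_log_of_pow_le (by norm_num) (by omega)
  have hpowK : 2 ^ K ≤ N := Nat.pow_log_le_self 2 (by omega)
  have hx₁pos : (0 : ℝ) < x₁ := by exact_mod_cast (show 0 < x₁ by omega)
  have hL0 : 0 < L := Real.log_pos (by exact_mod_cast (show 1 < N by omega))
  have hshift : ∀ k ∈ Icc 1 K, c₀ * (((N : ℝ) - (2 : ℝ) ^ k) - (if k = K then (x₁ : ℝ) else 0))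
      ≤ (Nat.primeCounting (N - 2 ^ k) : ℝ) * L := by
    intro k hk
    rw [mem_Icc] at hk
    have hpowk : 2 ^ k ≤ N := (Nat.pow_le_pow_right (by norm_num) hk.2).trans hpowK
    have hcast : ((N - 2 ^ k : ℕ) : ℝ) = (N : ℝ) - (2 : ℝ) ^ k := by
      rw [Nat.cast_sub hpowk]; push_cast; ring
    have hπ0 : (0 : ℝ) ≤ Nat.primeCounting (N - 2 ^ k) := Nat.cast_nonneg _
    by_cases hbig : x₁ ≤ N - 2 ^ k
    · have hx := hπ (N - 2 ^ k) hbig (Nat.sub_le _ _)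
      have hxge : (3 : ℝ) ≤ ((N - 2 ^ k : ℕ) : ℝ) := by exact_mod_cast (hx₁.trans hbig)
      have hxpos : (0 : ℝ) < ((N - 2 ^ k : ℕ) : ℝ) := by linarith
      have hlogx0 : 0 < Real.log ((N - 2 ^ k : ℕ) : ℝ) := Real.log_pos (by linarith)
      have hlogxL : Real.log ((N - 2 ^ k : ℕ) : ℝ) ≤ L :=
        Real.log_le_log hxpos (by rw [hcast]; linarith [pow_pos (show (0:ℝ) < 2 by norm_num) k])
      rw [div_le_iff₀ hlogx0] at hx
      have : c₀ * ((N - 2 ^ k : ℕ) : ℝ) ≤ (Nat.primeCounting (N - 2 ^ k) : ℝ) * L :=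
        hx.trans (mul_le_mul_of_nonneg_left hlogxL hπ0)
      rw [hcast] at this
      have hc : (0 : ℝ) ≤ c₀ * (if k = K then (x₁ : ℝ) else 0) := by
        split_ifs <;> positivity
      nlinarith
    · have hkK : k = K := by
        by_contra hne
        have hlt : k < K := lt_of_le_of_ne hk.2 hne
        have : 2 ^ (k + 1) ≤ 2 ^ K := Nat.pow_le_pow_right (by norm_num) hlt
        rw [pow_succ] at this
        omega
      rw [if_pos hkK]
      have hπL : (0 : ℝ) ≤ (Nat.primeCounting (N - 2 ^ k) : ℝ) * L := mul_nonneg hπ0 hL0.le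
      have hlt : (N : ℝ) - (2 : ℝ) ^ k < x₁ := by
        have h' : ((N - 2 ^ k : ℕ) : ℝ) < x₁ := by exact_mod_cast (show N - 2 ^ k < x₁ by omega)
        rw [hcast] at h'; exact h'
      have : c₀ * (((N : ℝ) - (2 : ℝ) ^ k) - x₁) ≤ 0 :=
        mul_nonpos_of_nonneg_of_nonpos hc₀ (by linarith)
      linarith
  have hsum := sum_le_sum hshift
  rw [← mul_sum, sum_sub_distrib, sum_sub_distrib, sum_const, Nat.card_Icc, sum_two_pow_Icc, sum_ite_eq',
    if_pos (mem_Icc.mpr ⟨hK1, le_rfl⟩), ← sum_mul] at hsum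
  simp only [add_tsub_cancel_right, nsmul_eq_mul] at hsum
  have hmain := natlog_main N (by omega)
  have hM1 := M1_ge N
  have hM1' : (∑ k ∈ Icc 1 K, (Nat.primeCounting (N - 2 ^ k) : ℝ)) * L ≤ M1 N * L :=
    mul_le_mul_of_nonneg_right hM1 hL0.le
  have hmono : c₀ * ((N : ℝ) * (L / Real.log 2 - 2) - x₁)
      ≤ c₀ * ((K : ℝ) * N - (2 * (2 : ℝ) ^ K - 2) - x₁) :=
    mul_le_mul_of_nonneg_left (by linarith) hc₀
  linarith

/-- **The density engine with a windowed `π`-input** (as the tree's `density_mul_param30`, the global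
`PrimeCountingLowerMul c₀ x₁` replaced by `c₀ n/log n ≤ π(n)` for `x₁ ≤ n ≤ N` only): a uniform pair sieve `A`
from `x₀`, `Λ ≥ 30`, `c₀ x₁ ≤ 0.01 e^Λ`, `2x₁ ≤ e^Λ`, a slope `s > 0` with `s L ≤ c₀ (1.4426 L − 2) − 0.01` for
`L ≥ Λ` ⇒ `#romanovSet N ≥ s²/(s + 4.035 A)·N` for `N ≥ max(x₀, e^Λ)`.
[cite: Nathanson1996, §7.6 Theorem 7.11 (Romanov's theorem) — explicit windowed parametric form proved here] -/
theorem density_mul_window {A x₀ c₀ s Λ : ℝ} {x₁ : ℕ} (hA : 0 ≤ A) (hPS : UniformPairSieve A x₀)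
    (hc₀ : 0 ≤ c₀) (hx₁ : 3 ≤ x₁) (hs : 0 < s) (hΛ : 30 ≤ Λ)
    (hsmall : c₀ * (x₁ : ℝ) ≤ 0.01 * Real.exp Λ) (hx₁Λ : (2 : ℝ) * x₁ ≤ Real.exp Λ)
    (hnum : ∀ L : ℝ, Λ ≤ L → s * L ≤ c₀ * (1.4426 * L - 2) - 0.01)
    {N : ℕ} (hπ : ∀ n : ℕ, x₁ ≤ n → n ≤ N → c₀ * (n : ℝ) / Real.log (n : ℝ) ≤ (Nat.primeCounting n : ℝ))
    (hx : x₀ ≤ (N : ℝ)) (hN : Real.exp Λ ≤ (N : ℝ)) :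
    s ^ 2 / (s + 4.035 * A) * (N : ℝ) ≤ ((romanovSet N).card : ℝ) := by
  have h30 : Real.exp 30 ≤ (N : ℝ) := (Real.exp_le_exp.mpr hΛ).trans hN
  have hNbig : (4 : ℝ) ≤ N := by
    have : (4 : ℝ) ≤ Real.exp 30 := by
      have := Real.add_one_le_exp (30 : ℝ); linarith
    linarith
  have hNpos : (0 : ℝ) < N := by linarith
  have hN2 : 2 ≤ N := by exact_mod_cast (show (2 : ℝ) ≤ N by linarith)
  have hlog2lo : (0.6931471803 : ℝ) < Real.log 2 := Real.log_two_gt_d9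
  have hlog2hi : Real.log 2 < 0.6931471808 := Real.log_two_lt_d9
  set L := Real.log (N : ℝ) with hL
  have hLΛ : Λ ≤ L := by
    have h := Real.log_le_log (Real.exp_pos Λ) hN
    rwa [Real.log_exp] at h
  have hL30 : (30 : ℝ) ≤ L := hΛ.trans hLΛ
  have hx₁N : 2 * x₁ ≤ N := by
    have : (2 : ℝ) * x₁ ≤ N := hx₁Λ.trans hN
    exact_mod_cast this
  have h1 := M1_ge_mul_window (c₀ := c₀) (x₁ := x₁) hc₀ hx₁ (N := N) hπ hx₁N
  have hinv : (1.4426 : ℝ) * L ≤ L / Real.log 2 := by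
    rw [le_div_iff₀ (by linarith)]; nlinarith
  have hM1 : s * (N : ℝ) ≤ M1 N := by
    have hstep1 : c₀ * ((N : ℝ) * (1.4426 * L - 2) - x₁) ≤ c₀ * ((N : ℝ) * (L / Real.log 2 - 2) - x₁) := by
      apply mul_le_mul_of_nonneg_left _ hc₀
      nlinarith [mul_le_mul_of_nonneg_left hinv hNpos.le]
    have hstep2 : s * (N : ℝ) * L ≤ c₀ * ((N : ℝ) * (1.4426 * L - 2) - x₁) := by
      have hn := hnum L hLΛ
      have hsm : c₀ * (x₁ : ℝ) ≤ 0.01 * (N : ℝ) := hsmall.trans (by nlinarith)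
      have : s * L * (N : ℝ) ≤ (c₀ * (1.4426 * L - 2) - 0.01) * (N : ℝ) :=
        mul_le_mul_of_nonneg_right hn hNpos.le
      nlinarith
    have hkey : s * (N : ℝ) * L ≤ M1 N * L := (hstep2.trans hstep1).trans h1
    exact le_of_mul_le_mul_right hkey (by linarith)
  have h2 := M2_le_final hA hPS powTwoShiftMeanLe_193841 hx hN2
  have hB : A * 1.93841 / Real.log 2 ^ 2 ≤ 4.035 * A := by
    rw [div_le_iff₀ (by positivity)]
    have hsq : (0.48045 : ℝ) ≤ Real.log 2 ^ 2 := by nlinarith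
    nlinarith [mul_le_mul_of_nonneg_left hsq hA]
  have hM2 : M2 N ≤ M1 N + 4.035 * A * (N : ℝ) := by
    have : A * 1.93841 / Real.log 2 ^ 2 * (N : ℝ) ≤ 4.035 * A * (N : ℝ) :=
      mul_le_mul_of_nonneg_right hB hNpos.le
    linarith
  exact density_of_moments hs (by positivity) hM1 hM2

/-! ## §3 The windows `[e^{32}, e^{60}]` (constant `1/32`) and `[e^{34}, e^{60}]` (`1/31`) -/

/-- `2^32 ≤ e^{32}`, hence `1700 ≤ 0.01·e^{32}` and `34 ≤ e^{32}`. [folklore] -/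
private theorem exp_32_ge : (4294967296 : ℝ) ≤ Real.exp 32 := by
  have he : (2 : ℝ) ≤ Real.exp 1 := by have := Real.exp_one_gt_d9; linarith
  have h : (2 : ℝ) ^ 32 ≤ Real.exp 32 := by
    rw [show (32 : ℝ) = ((32 : ℕ) : ℝ) * 1 by norm_num, Real.exp_nat_mul]
    exact pow_le_pow_left₀ (by norm_num) he 32
  exact le_trans (by norm_num) h

/-- The windowed `π`-hypothesis with `c₀ = 1`, `x₁ = 17`, for every `N ≤ e^{60}` (part A). [folklore] -/
private theorem window_hyp {N : ℕ} (h60 : (N : ℝ) ≤ Real.exp 60) :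
    ∀ n : ℕ, 17 ≤ n → n ≤ N → 1 * (n : ℝ) / Real.log (n : ℝ) ≤ (Nat.primeCounting n : ℝ) := by
  intro n h17 hnN
  rw [one_mul]
  have hn : (n : ℝ) ≤ N := by exact_mod_cast hnN
  exact le_primeCounting_of_le_exp60 h17 (hn.trans h60)

/-- **`e^{32} ≤ N ≤ e^{60}`: `#romanovSet N ≥ N/32`** (`A = 14.35` from `e^{32}`, `c₀ = 1` on the window, `s = 1.3797`:
`1.3797²/(1.3797 + 4.035·14.35) = 0.03211 ≥ 1/32`). [cite: Nathanson1996, §7.6 Theorem 7.11 (Romanov's theorem) —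
explicit form with constant 1/32 on [e^32, e^60] proved here] -/
theorem romanov_ge_div32_window {N : ℕ} (h32 : Real.exp 32 ≤ (N : ℝ)) (h60 : (N : ℝ) ≤ Real.exp 60) :
    (1 / 32 : ℝ) * (N : ℝ) ≤ ((romanovSet N).card : ℝ) := by
  have hd := density_mul_window (A := 14.35) (x₀ := Real.exp 32) (c₀ := 1) (s := 1.3797) (Λ := 32)
    (x₁ := 17) (by norm_num) uniformPairSieve_1435 (by norm_num) (by norm_num) (by norm_num) (by norm_num)
    (by push_cast; linarith [exp_32_ge]) (by push_cast; linarith [exp_32_ge])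
    (fun L hL => by nlinarith) (window_hyp h60) h32 h32
  have hc : (1 / 32 : ℝ) ≤ (1.3797 : ℝ) ^ 2 / (1.3797 + 4.035 * 14.35) := by norm_num
  have hN0 : (0 : ℝ) ≤ N := Nat.cast_nonneg N
  nlinarith

/-- **`e^{34} ≤ N ≤ e^{60}`: `#romanovSet N ≥ N/31`** (`s = 1.3831`: `1.3831²/(1.3831 + 57.90225) = 0.032267 ≥ 1/31`).
[cite: Nathanson1996, §7.6 Theorem 7.11 (Romanov's theorem) — explicit form with constant 1/31 on [e^34, e^60] proved here] -/
theorem romanov_ge_div31_window {N : ℕ} (h34 : Real.exp 34 ≤ (N : ℝ)) (h60 : (N : ℝ) ≤ Real.exp 60) :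
    (1 / 31 : ℝ) * (N : ℝ) ≤ ((romanovSet N).card : ℝ) := by
  have h3234 : Real.exp 32 ≤ Real.exp 34 := Real.exp_le_exp.mpr (by norm_num)
  have hd := density_mul_window (A := 14.35) (x₀ := Real.exp 32) (c₀ := 1) (s := 1.3831) (Λ := 34)
    (x₁ := 17) (by norm_num) uniformPairSieve_1435 (by norm_num) (by norm_num) (by norm_num) (by norm_num)
    (by push_cast; linarith [exp_32_ge]) (by push_cast; linarith [exp_32_ge])
    (fun L hL => by nlinarith) (window_hyp h60) (h3234.trans h34) h34
  have hc : (1 / 31 : ℝ) ≤ (1.3831 : ℝ) ^ 2 / (1.3831 + 4.035 * 14.35) := by norm_num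
  have hN0 : (0 : ℝ) ≤ N := Nat.cast_nonneg N
  nlinarith

/-- **`N ≥ e^{34}`: `#romanovSet N ≥ N/31`, unconditionally** (tree: from `e^{38}`). [cite: Nathanson1996, §7.6
Theorem 7.11 (Romanov's theorem) — explicit form with constant 1/31 from e^34 proved here] -/
theorem romanov_ge_div31_from_exp34 {N : ℕ} (h34 : Real.exp 34 ≤ (N : ℝ)) :
    (1 / 31 : ℝ) * (N : ℝ) ≤ ((romanovSet N).card : ℝ) := by
  by_cases h60 : (N : ℝ) ≤ Real.exp 60
  · exact romanov_ge_div31_window h34 h60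
  · push Not at h60
    exact romanov_ge_div31 (le_trans (Real.exp_le_exp.mpr (by norm_num)) h60.le)

/-- **`N ≥ e^{32}`: `#romanovSet N ≥ N/32`, unconditionally.** [cite: Nathanson1996, §7.6 Theorem 7.11 (Romanov's
theorem) — explicit form with constant 1/32 from e^32 proved here] -/
theorem romanov_ge_div32_from_exp32 {N : ℕ} (h32 : Real.exp 32 ≤ (N : ℝ)) :
    (1 / 32 : ℝ) * (N : ℝ) ≤ ((romanovSet N).card : ℝ) := by
  by_cases h60 : (N : ℝ) ≤ Real.exp 60
  · exact romanov_ge_div32_window h32 h60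
  · push Not at h60
    have h := romanov_ge_div31 (le_trans (Real.exp_le_exp.mpr (by norm_num)) h60.le)
    have hN0 : (0 : ℝ) ≤ N := Nat.cast_nonneg N
    nlinarith

/-! ## §4 Below `e^{32}`: one shift `p + 2`, constant `1/32` -/

set_option maxRecDepth 200000 in
/-- Every entry of `smallPrimes` is prime (private copy of the `PrimeCountingAbel` certificate). [folklore] -/
private theorem smallPrimes_prime' : ∀ p ∈ smallPrimes, p.Prime := by
  simp only [smallPrimes, List.forall_mem_cons]
  exact ⟨by norm_num, by norm_num, by norm_num, by norm_num, by norm_num, by norm_num, by norm_num, by norm_num, by norm_num, by norm_num, by norm_num, by norm_num, by norm_num, by norm_num, by norm_num, by norm_num, by norm_num, by norm_num, by norm_num, by norm_num, by norm_num, by norm_num, by norm_num, by norm_num, by norm_num, by norm_num, by norm_num, by norm_num, by norm_num, by norm_num, by norm_num, by norm_num, by norm_num, by norm_num, by norm_num, by norm_num, by norm_num, by norm_num, by norm_num, by norm_num, by norm_num, by norm_num, by norm_num, by norm_num, by norm_num, by norm_num, by norm_num, by norm_num, by norm_num, by norm_num, by norm_num, by norm_num, by norm_num, by norm_num, by norm_num,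 by norm_num, by norm_num, by norm_num, by norm_num, by norm_num, by norm_num, by norm_num, by norm_num, by norm_num, by norm_num, by norm_num, by norm_num, by norm_num, by norm_num, by norm_num, by norm_num, by norm_num, by norm_num, by norm_num, by norm_num, by norm_num, by norm_num, by norm_num, by norm_num, by norm_num, by norm_num, by norm_num, by norm_num, by norm_num, by norm_num, by norm_num, by norm_num, by norm_num, by norm_num, by norm_num, by norm_num, by norm_num, by norm_num, by norm_num, by norm_num, by norm_num, by norm_num, by norm_num, by norm_num, by norm_num, by norm_num, by norm_num, by norm_num, by norm_num, by norm_num, by norm_num, by norm_num, by norm_num, by norm_num, by norm_num, by norm_num, by norm_num, by norm_num, by norm_num, by norm_num, by norm_num, by norm_num, by norm_num, by norm_num, by norm_num, by norm_num, by norm_num, by norm_num, by norm_num, by norm_num, by norm_num, by norm_num, by norm_num, by norm_num, by norm_num, by norm_num, by norm_num, by norm_num, by norm_num, by norm_num, by norm_num, by norm_num, by norm_num, by norm_num, by norm_num, by norm_num, by norm_num, by norm_num, by norm_num, by norm_num, by norm_num, by norm_num, by norm_num, by norm_num, by norm_num, by norm_num, by norm_num, by norm_num, by norm_num, by norm_num,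 by norm_num, by norm_num, by norm_num, by norm_num, by norm_num, by norm_num, by norm_num, by norm_num, by norm_num, by norm_num, by norm_num, by norm_num, by norm_num, by norm_num, by norm_num, by norm_num, by norm_num, by norm_num, by norm_num, by norm_num, by norm_num, by norm_num, by norm_num, by norm_num, by norm_num, by norm_num, by norm_num, by norm_num, by norm_num, by norm_num, by norm_num, by norm_num, by norm_num, by norm_num, by norm_num, by norm_num, by norm_num, by norm_num, by norm_num, by norm_num, by norm_num, by norm_num, by norm_num, by norm_num, by norm_num, by norm_num, by norm_num, by norm_num, by norm_num, by norm_num, by norm_num, by norm_num, by norm_num, by norm_num, by norm_num, by norm_num, by norm_num, by norm_num, by norm_num, by norm_num, by norm_num, by norm_num, by norm_num, by norm_num, by norm_num, by norm_num, by norm_num, by norm_num, by norm_num, by norm_num, by norm_num, by norm_num, by norm_num, by norm_num, by norm_num, by norm_num, by norm_num, by norm_num, by norm_num, by norm_num, by norm_num, by norm_num, by norm_num, by norm_num, by norm_num, by norm_num, by norm_num, by norm_num, by norm_num, by norm_num, by norm_num, by norm_num, by norm_num, by norm_num, by norm_num, by norm_num, by norm_num, by norm_num, by norm_num, by norm_num,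 by norm_num, by norm_num, by norm_num, by norm_num, by norm_num, by norm_num, by norm_num, by norm_num, by norm_num, by norm_num, by norm_num, by norm_num, by norm_num, by norm_num, by norm_num, by norm_num, by norm_num, by norm_num, by norm_num, by norm_num, by norm_num, by norm_num, by norm_num, by norm_num, by norm_num, by norm_num, by norm_num, by norm_num, by norm_num, by norm_num, by norm_num, by norm_num, by norm_num, by norm_num, by norm_num, by norm_num, by norm_num, by norm_num, by norm_num, by norm_num, by norm_num, by norm_num, by norm_num, by norm_num, by norm_num, by norm_num, by norm_num, by norm_num, by norm_num, by norm_num, by norm_num, by norm_num, by norm_num, by norm_num, by norm_num, by norm_num, by norm_num, by norm_num, by norm_num, by norm_num, by norm_num, by norm_num, by norm_num, by norm_num, by norm_num, by norm_num, by norm_num, by norm_num, by norm_num, by norm_num, by norm_num, by norm_num, by norm_num, by norm_num, by norm_num, by norm_num, by norm_num, by norm_num, by norm_num, by norm_num, by norm_num, by norm_num, by norm_num, by norm_num, by norm_num, by norm_num, by norm_num, by norm_num, by norm_num, by norm_num, by norm_num, by norm_num, by norm_num, by norm_num, by norm_num, by norm_num, by norm_num, by norm_num, by norm_num, by norm_num,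 by norm_num, by norm_num, by norm_num, by norm_num, by norm_num, by norm_num, by norm_num, by norm_num, by norm_num, by norm_num, by norm_num, by norm_num, by norm_num, by norm_num, by norm_num, by norm_num, by norm_num, by norm_num, by norm_num, by norm_num, by norm_num, by norm_num, by norm_num, by norm_num, by norm_num, by norm_num, by norm_num, by norm_num, by norm_num, by norm_num, by norm_num, by norm_num, by norm_num, by norm_num, by norm_num, by norm_num, by norm_num, by norm_num, by norm_num, by norm_num, by norm_num, by norm_num, by norm_num, by norm_num, by norm_num, by norm_num, by norm_num, by norm_num, by norm_num, by norm_num, by norm_num, by norm_num, by norm_num, by norm_num, by norm_num, by norm_num, by norm_num, by norm_num, by norm_num, by norm_num, by norm_num, by norm_num, by norm_num, by norm_num, by norm_num, by norm_num, by norm_num, by norm_num, by norm_num, by norm_num, by norm_num, by norm_num, by norm_num, by norm_num, by simp⟩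

set_option maxRecDepth 200000 in
set_option maxHeartbeats 8000000 in
/-- `smallPrimes` has no duplicates (private copy). [folklore] -/
private theorem smallPrimes_nodup' : smallPrimes.Nodup := by
  decide +kernel

/-- `π(x) ≥ #{p ∈ smallPrimes : p ≤ x}` (private copy). [folklore] -/
private theorem le_primeCounting_of' (x n : ℕ) (h : n ≤ (smallPrimes.filter (· ≤ x)).length) :
    n ≤ Nat.primeCounting x := by
  rw [← Nat.primesLE_card_eq_primeCounting]
  have hnd : (smallPrimes.filter (· ≤ x)).Nodup := smallPrimes_nodup'.filter _
  rw [← List.toFinset_card_of_nodup hnd] at h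
  refine h.trans (Finset.card_le_card ?_)
  intro p hp
  rw [List.mem_toFinset, List.mem_filter] at hp
  rw [Nat.mem_primesLE]
  exact ⟨by simpa using hp.2, smallPrimes_prime' p hp.1⟩


set_option maxRecDepth 200000 in
/-- `4 ≤ N < 5395`: `N/32 ≤ π(N − 2)` by four checkpoints (`π(2), π(30), π(318), π(2110) ≥ 1, 10, 66, 317`). [folklore] -/
private theorem small_range32 {N : ℕ} (h4 : 4 ≤ N) (h : N < 5395) :
    (1 / 32 : ℝ) * (N : ℝ) ≤ (Nat.primeCounting (N - 2) : ℝ) := by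
  have mono : ∀ {a b : ℕ}, a ≤ b → Nat.primeCounting a ≤ Nat.primeCounting b :=
    fun hab => Nat.monotone_primeCounting hab
  have step : ∀ (x n M : ℕ), n ≤ Nat.primeCounting x → x ≤ N - 2 → N < M → (M : ℝ) ≤ 32 * n →
      (1 / 32 : ℝ) * (N : ℝ) ≤ (Nat.primeCounting (N - 2) : ℝ) := by
    intro x n M hn hx hM hMn
    have h1 : (n : ℝ) ≤ Nat.primeCounting (N - 2) := by exact_mod_cast hn.trans (mono hx)
    have h2 : (N : ℝ) < M := by exact_mod_cast hM
    linarith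
  by_cases h32 : N < 32
  · exact step 2 1 32 (le_primeCounting_of' 2 1 (by decide)) (by omega) h32 (by norm_num)
  by_cases h320 : N < 320
  · exact step 30 10 320 (le_primeCounting_of' 30 10 (by decide)) (by omega) h320 (by norm_num)
  by_cases h2112 : N < 2112
  · exact step 318 66 2112 (le_primeCounting_of' 318 66 (by decide)) (by omega) h2112 (by norm_num)
  · exact step 2110 317 5395 (le_primeCounting_of' 2110 317 (by decide)) (by omega) h (by norm_num)

/-- `5395 ≤ N ≤ e^{32}` (via `log N ≤ 32`): `N/32 ≤ π(N − 2)`.  For `log(N − 2) ≤ 31` from `π(n) ≥ n/log n`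
(`32 (N − 2) ≥ 31 N` iff `N ≥ 64`); on the last unit from the junction `π(n) ≥ 1.003 n/log n ≥ 1.003 (N − 2)/32`
(`1.003 (N − 2) ≥ N` iff `N ≥ 669`). [folklore] -/
private theorem mid_range32 {N : ℕ} (h1 : 5395 ≤ N) (h2 : Real.log (N : ℝ) ≤ 32) :
    (1 / 32 : ℝ) * (N : ℝ) ≤ (Nat.primeCounting (N - 2) : ℝ) := by
  have hcast : ((N - 2 : ℕ) : ℝ) = (N : ℝ) - 2 := by
    rw [Nat.cast_sub (by omega)]; norm_num
  have hN : (5395 : ℝ) ≤ N := by exact_mod_cast h1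
  have hNpos : (0 : ℝ) < N := by linarith
  have hN32 : (N : ℝ) ≤ Real.exp 32 := by
    by_contra h
    push Not at h
    have := Real.log_lt_log (Real.exp_pos 32) h
    rw [Real.log_exp] at this
    linarith
  have hn60 : (((N - 2 : ℕ)) : ℝ) ≤ Real.exp 60 := by
    rw [hcast]; linarith [Real.exp_le_exp.mpr (show (32 : ℝ) ≤ 60 by norm_num)]
  have hπ0 : (0 : ℝ) ≤ Nat.primeCounting (N - 2) := Nat.cast_nonneg _
  have hlogpos : 0 < Real.log ((N : ℝ) - 2) := Real.log_pos (by linarith)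
  by_cases h31 : Real.log ((N : ℝ) - 2) ≤ 31
  · have hx := le_primeCounting_of_le_exp60 (n := N - 2) (by omega) hn60
    rw [hcast, div_le_iff₀ hlogpos] at hx
    have : (Nat.primeCounting (N - 2) : ℝ) * Real.log ((N : ℝ) - 2) ≤ (Nat.primeCounting (N - 2) : ℝ) * 31 :=
      mul_le_mul_of_nonneg_left h31 hπ0
    linarith
  · push Not at h31
    have he31 : Real.exp 31 ≤ (N : ℝ) - 2 := by
      by_contra h
      push Not at h
      have := Real.log_lt_log (by linarith) h
      rw [Real.log_exp] at this
      linarith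
    have hx := le_primeCounting_floor_junction ((N : ℝ) - 2) he31 (by linarith)
    have hfl : ⌊(N : ℝ) - 2⌋₊ = N - 2 := by
      rw [← hcast, Nat.floor_natCast]
    rw [hfl, div_le_iff₀ hlogpos] at hx
    have hlogle : Real.log ((N : ℝ) - 2) ≤ 32 :=
      (Real.log_le_log (by linarith) (by linarith)).trans h2
    have : (Nat.primeCounting (N - 2) : ℝ) * Real.log ((N : ℝ) - 2) ≤ (Nat.primeCounting (N - 2) : ℝ) * 32 :=
      mul_le_mul_of_nonneg_left hlogle hπ0
    linarith

/-- `4 ≤ N`, `log N ≤ 32`: `N/32 ≤ #romanovSet N`. [folklore] -/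
private theorem finite_range32 {N : ℕ} (h4 : 4 ≤ N) (hlog : Real.log (N : ℝ) ≤ 32) :
    (1 / 32 : ℝ) * (N : ℝ) ≤ ((romanovSet N).card : ℝ) := by
  have hR : (Nat.primeCounting (N - 2) : ℝ) ≤ ((romanovSet N).card : ℝ) := by
    exact_mod_cast primeCounting_le_card_romanovSet N
  by_cases h1 : N < 5395
  · exact (small_range32 h4 h1).trans hR
  · exact (mid_range32 (by omega) hlog).trans hR

/-! ## §5 The headline -/

/-- ★ **ROMANOFF'S THEOREM, EXPLICIT, UNIFORM IN `N`, UNCONDITIONAL, constant `1/32`**: for every `N ≥ 4`,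
`#{n ≤ N : n = p + 2^k, p prime, k ≥ 1} ≥ N/32` (tree: `1/34`, `1/40`, `1/45`, `1/79`).  Above `e^{32}` from §R3
(window `c₀ = 1`, `2.7 %` to spare), below by one shift with `π(n) ≥ n/log n` (`17 ≤ n ≤ e^{60}`, part A) and the
`1.003` junction regime; no named fact anywhere.
[cite: Nathanson1996, §7.6 Theorem 7.11 (Romanov's theorem) — explicit-uniform form with constant 1/32 proved here] -/
theorem romanoffAllN_32 : RomanoffAllN (1 / 32 : ℝ) 4 := by
  intro N hN
  by_cases hlog : Real.log (N : ℝ) ≤ 32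
  · exact finite_range32 hN hlog
  · push Not at hlog
    have hNpos : (0 : ℝ) < N := by exact_mod_cast (show 0 < N by omega)
    have h32 : Real.exp 32 ≤ (N : ℝ) := by
      by_contra h
      push Not at h
      have := Real.log_lt_log hNpos h
      rw [Real.log_exp] at this
      linarith
    exact romanov_ge_div32_from_exp32 h32

/-- The same, unfolded: `∀ N ≥ 4, N/32 ≤ #romanovSet N`. [cite: Nathanson1996, §7.6 Theorem 7.11 (Romanov's theorem) —
explicit-uniform form with constant 1/32 proved here] -/
theorem romanoffAllN_32_statement :
    ∀ N : ℕ, 4 ≤ N → (1 / 32 : ℝ) * (N : ℝ) ≤ ((romanovSet N).card : ℝ) := romanoffAllN_32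

/-- Part A restated in the tree's vocabulary: **`PrimeCountingLowerMul 0.9844 17`** (tree instances: `0.9636` from
`227`, `0.984437` from `4.468·10⁴²`). [cite: CostaPereira1989, Theorem 2 (2.34) (method for the `ψ`-inputs); constant
and range proved here] -/
theorem primeCountingLowerMul_09844 : PrimeCountingLowerMul 0.9844 17 :=
  fun _ hn => primeCounting_ge_09844 hn


/-!
## Part S — two shifts `p + 2`, `p + 4` below `e^{34}`: Romanoff's theorem with constant `1/31` for every `N ≥ 4`

Part R's junction (one shift `p + 2`) caps the all-`N` constant at `1/32` (`π(N − 2) ≥ N/31` up to `log N = 34` would need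
`π(x) ≥ 1.097·x/log x`).  Two shifts remove the cap: `#romanovSet N ≥ π(N − 2) + π(N − 4) − #{p ≤ N − 4 : p, p + 2 prime}`
(the images of `p ↦ p + 2` and `p ↦ p + 4` meet exactly on the twin pairs), the twin count is at most the tree's pair sieve
`pairCount_le_1435` (`14.35·x/log²x`, `x ≥ e^{32}`; below `e^{32}` evaluated at `⌈e^{32}⌉` by monotonicity), and
`2/log N − 14.35/log²` beats `1/31` with room (`0.0448` at `log N = 34`).  The one-shift ranges below need `π` slightly
above `x/log x` on `(e^{30}, e^{31.2}]`: two more Abel regimes (`C = 1.003` on `[e^{30}, e^{31}]`, `C = 1.008` on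
`[e^{31}, e^{31.2}]`, `PrimeCountingAbel.le_primeCounting_floor_reg30/_reg31`).  Result: ★ `romanoffAllN_31 : RomanoffAllN (1/31) 4` — the all-`N` constant now EQUALS the
architecture's large-range constant (`romanov_ge_div31`: `A = 13.01`, `c₀ = 0.9636`, `s = 1.339` from `e^{38}`).
-/

open Literature.NumberTheory.Sieve.GoldbachLinnik (oddSingularFactor oddSingularFactor_two_pow_mul oddSingularFactor_one)

/-! ## §S2 Two shifts and the twin overlap -/

/-- The twin-type count `#{p ≤ x : p prime, p + 2 prime}` (the tree's `pairCount x 2` as a filter of `primesLE`). [folklore] -/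
def twinLE (x : ℕ) : ℕ := ((Nat.primesLE x).filter fun p => (p + 2).Prime).card

/-- `twinLE` is monotone. [folklore] -/
private theorem twinLE_mono {x y : ℕ} (h : x ≤ y) : twinLE x ≤ twinLE y := by
  unfold twinLE
  refine card_le_card (fun p hp => ?_)
  rw [mem_filter, Nat.mem_primesLE] at hp ⊢
  exact ⟨⟨hp.1.1.trans h, hp.1.2⟩, hp.2⟩

/-- `f(2) = 1` for the odd singular factor. [folklore] -/
private theorem oddSingularFactor_two : oddSingularFactor 2 = 1 := by
  have h := oddSingularFactor_two_pow_mul 1 (n := 1) one_ne_zero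
  rw [oddSingularFactor_one] at h
  simpa using h

/-- The tree's pair sieve at `h = 2`: `twinLE x ≤ 14.35·x/1024` for `x ≥ e^{32}` (`log x ≥ 32`). [folklore] -/
private theorem twinLE_le {x : ℕ} (hx : Real.exp 32 ≤ (x : ℝ)) : (twinLE x : ℝ) ≤ 14.35 * (x : ℝ) / 1024 := by
  have h := pairCount_le_1435 (N := x) (h := 2) hx two_ne_zero even_two
  rw [oddSingularFactor_two, mul_one] at h
  have hxpos : (0 : ℝ) < x := lt_of_lt_of_le (Real.exp_pos 32) hx
  have hlog : (32 : ℝ) ≤ Real.log (x : ℝ) := by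
    have := Real.log_le_log (Real.exp_pos 32) hx
    rwa [Real.log_exp] at this
  have hlog2 : (1024 : ℝ) ≤ Real.log (x : ℝ) ^ 2 := by nlinarith
  have hmono : 14.35 * (x : ℝ) / Real.log (x : ℝ) ^ 2 ≤ 14.35 * (x : ℝ) / 1024 :=
    div_le_div_of_nonneg_left (by positivity) (by norm_num) hlog2
  unfold twinLE
  exact h.trans hmono

/-- **Two shifts**: `π(N − 2) + π(N − 4) − twinLE (N − 4) ≤ #romanovSet N` (`N ≥ 4`): the images of `p ↦ p + 2`
(`p ≤ N − 2`) and `p ↦ p + 4` (`p ≤ N − 4`) lie in Romanov's set and meet only above twin pairs `(q, q + 2)`, `q ≤ N − 4`.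
[folklore] -/
private theorem two_shifts_le {N : ℕ} (h4 : 4 ≤ N) :
    (Nat.primeCounting (N - 2) : ℝ) + (Nat.primeCounting (N - 4) : ℝ) - (twinLE (N - 4) : ℝ)
      ≤ ((romanovSet N).card : ℝ) := by
  classical
  set A : Finset ℕ := (Nat.primesLE (N - 2)).image (· + 2) with hA
  set B : Finset ℕ := (Nat.primesLE (N - 4)).image (· + 4) with hB
  have hAc : A.card = Nat.primeCounting (N - 2) := by
    rw [hA, card_image_of_injective _ (add_left_injective 2), Nat.primesLE_card_eq_primeCounting]
  have hBc : B.card = Nat.primeCounting (N - 4) := by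
    rw [hB, card_image_of_injective _ (add_left_injective 4), Nat.primesLE_card_eq_primeCounting]
  have hsub : A ∪ B ⊆ romanovSet N := by
    intro m hm
    rw [mem_union] at hm
    simp only [Romanov.romanovSet, mem_filter, mem_range]
    rcases hm with hm | hm
    · rw [hA, mem_image] at hm
      obtain ⟨p, hp, rfl⟩ := hm
      rw [Nat.mem_primesLE] at hp
      exact ⟨by omega, p, 1, hp.2, le_rfl, by ring⟩
    · rw [hB, mem_image] at hm
      obtain ⟨p, hp, rfl⟩ := hm
      rw [Nat.mem_primesLE] at hp
      exact ⟨by omega, p, 2, hp.2, by norm_num, by ring⟩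
  have hinter : (A ∩ B).card ≤ twinLE (N - 4) := by
    unfold twinLE
    have hsub' : A ∩ B ⊆ ((Nat.primesLE (N - 4)).filter fun p => (p + 2).Prime).image (· + 4) := by
      intro m hm
      rw [mem_inter, hA, hB, mem_image, mem_image] at hm
      obtain ⟨⟨p, hp, hpm⟩, ⟨q, hq, hqm⟩⟩ := hm
      rw [Nat.mem_primesLE] at hp hq
      rw [mem_image]
      refine ⟨q, ?_, hqm⟩
      rw [mem_filter, Nat.mem_primesLE]
      have hpq : p = q + 2 := by omega
      exact ⟨hq, hpq ▸ hp.2⟩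
    exact (card_le_card hsub').trans card_image_le
  have hunion := card_union_add_card_inter A B
  have hR := card_le_card hsub
  have key : Nat.primeCounting (N - 2) + Nat.primeCounting (N - 4) ≤ (romanovSet N).card + twinLE (N - 4) := by
    rw [← hAc, ← hBc, ← hunion]; omega
  have key' : (Nat.primeCounting (N - 2) : ℝ) + (Nat.primeCounting (N - 4) : ℝ)
      ≤ ((romanovSet N).card : ℝ) + (twinLE (N - 4) : ℝ) := by exact_mod_cast key
  linarith

/-! ## §S3 Numerical constants -/

/-- `e^{0.8} ≤ 2.2256` (fifth powers: `e^4 < 2.7182818286^4 ≤ 2.2256^5`). [folklore] -/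
private theorem exp_08_le : Real.exp 0.8 ≤ 2.2256 := by
  have h5 : Real.exp 0.8 ^ 5 = Real.exp 1 ^ 4 := by
    rw [← Real.exp_nat_mul, ← Real.exp_nat_mul]; norm_num
  have h1 : Real.exp 1 ^ 4 < (2.7182818286 : ℝ) ^ 4 :=
    pow_lt_pow_left₀ Real.exp_one_lt_d9 (Real.exp_pos 1).le (by norm_num)
  have h2 : ((2.7182818286 : ℝ)) ^ 4 ≤ (2.2256 : ℝ) ^ 5 := by norm_num
  have h3 : Real.exp 0.8 ^ 5 ≤ (2.2256 : ℝ) ^ 5 := by rw [h5]; exact (h1.trans_le h2).le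
  exact (pow_le_pow_iff_left₀ (Real.exp_pos _).le (by norm_num) (by norm_num)).mp h3

/-- `e^{1/2} ≤ 1.6487213` (squares). [folklore] -/
private theorem exp_05_le : Real.exp 0.5 ≤ 1.6487213 := by
  have h2 : Real.exp 0.5 ^ 2 = Real.exp 1 := by
    rw [← Real.exp_nat_mul]; norm_num
  have h3 : Real.exp 0.5 ^ 2 ≤ (1.6487213 : ℝ) ^ 2 := by
    rw [h2]; exact (Real.exp_one_lt_d9.trans_le (by norm_num)).le
  exact (pow_le_pow_iff_left₀ (Real.exp_pos _).le (by norm_num) (by norm_num)).mp h3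

/-- `e^{31} + 2 ≤ e^{31.2}`. [folklore] -/
private theorem exp_31_add_two_le : Real.exp 31 + 2 ≤ Real.exp 31.2 := by
  have h : Real.exp 31.2 = Real.exp 31 * Real.exp 0.2 := by rw [← Real.exp_add]; norm_num
  have h02 : (1.2 : ℝ) ≤ Real.exp 0.2 := by have := Real.add_one_le_exp (0.2 : ℝ); linarith
  have h31 : (10 : ℝ) ≤ Real.exp 31 := by have := Real.add_one_le_exp (31 : ℝ); linarith
  rw [h]; nlinarith [Real.exp_pos 31]

/-- `e^{32} = e^{0.8}·e^{31.2} ≤ 2.2256·y` for `y ≥ e^{31.2}`, and `e^{32} ≤ 1.6487213·y` for `y ≥ e^{31.5}`. [folklore] -/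
private theorem exp_32_le_mul {y : ℝ} :
    (Real.exp 31.2 ≤ y → Real.exp 32 ≤ 2.2256 * y) ∧ (Real.exp 31.5 ≤ y → Real.exp 32 ≤ 1.6487213 * y) := by
  constructor
  · intro hy
    have h : Real.exp 32 = Real.exp 0.8 * Real.exp 31.2 := by rw [← Real.exp_add]; norm_num
    rw [h]
    exact mul_le_mul exp_08_le hy (Real.exp_pos _).le (by norm_num)
  · intro hy
    have h : Real.exp 32 = Real.exp 0.5 * Real.exp 31.5 := by rw [← Real.exp_add]; norm_num
    rw [h]
    exact mul_le_mul exp_05_le hy (Real.exp_pos _).le (by norm_num)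

/-! ## §S4 The ranges below `e^{34}` with constant `1/31` -/

/-- `exp a ≤ x` from `a ≤ log x` and `x ≤ exp b` from `log x ≤ b` (`x > 0`). [folklore] -/
private theorem exp_le_of_le_log' {a x : ℝ} (hx : 0 < x) (h : a ≤ Real.log x) : Real.exp a ≤ x := by
  by_contra hc
  push Not at hc
  have := Real.log_lt_log hx hc
  rw [Real.log_exp] at this
  linarith

/-- Companion of the previous lemma. [folklore] -/
private theorem le_exp_of_log_le' {b x : ℝ} (hx : 0 < x) (h : Real.log x ≤ b) : x ≤ Real.exp b := by
  by_contra hc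
  push Not at hc
  have hx' : 0 < x := hx
  have := Real.log_lt_log (Real.exp_pos b) hc
  rw [Real.log_exp] at this
  linarith

set_option maxRecDepth 200000 in
/-- `4 ≤ N < 5395`: `N/31 ≤ π(N − 2)` by four checkpoints (`π(2), π(29), π(308), π(1951) ≥ 1, 10, 63, 297`). [folklore] -/
private theorem small_range31 {N : ℕ} (h4 : 4 ≤ N) (h : N < 5395) :
    (1 / 31 : ℝ) * (N : ℝ) ≤ (Nat.primeCounting (N - 2) : ℝ) := by
  have mono : ∀ {a b : ℕ}, a ≤ b → Nat.primeCounting a ≤ Nat.primeCounting b :=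
    fun hab => Nat.monotone_primeCounting hab
  have step : ∀ (x n M : ℕ), n ≤ Nat.primeCounting x → x ≤ N - 2 → N < M → (M : ℝ) ≤ 31 * n →
      (1 / 31 : ℝ) * (N : ℝ) ≤ (Nat.primeCounting (N - 2) : ℝ) := by
    intro x n M hn hx hM hMn
    have h1 : (n : ℝ) ≤ Nat.primeCounting (N - 2) := by exact_mod_cast hn.trans (mono hx)
    have h2 : (N : ℝ) < M := by exact_mod_cast hM
    linarith
  by_cases h31 : N < 31
  · exact step 2 1 31 (le_primeCounting_of' 2 1 (by decide)) (by omega) h31 (by norm_num)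
  by_cases h310 : N < 310
  · exact step 29 10 310 (le_primeCounting_of' 29 10 (by decide)) (by omega) h310 (by norm_num)
  by_cases h1953 : N < 1953
  · exact step 308 63 1953 (le_primeCounting_of' 308 63 (by decide)) (by omega) h1953 (by norm_num)
  · exact step 1951 297 5395 (le_primeCounting_of' 1951 297 (by decide)) (by omega) h (by norm_num)

/-- F1: `5395 ≤ N`, `log(N − 2) ≤ 30`: `N/31 ≤ π(N − 2)` from `π(n) ≥ n/log n` (`31 (N − 2) ≥ 30 N` iff `N ≥ 62`). [folklore] -/
private theorem range31_F1 {N : ℕ} (h1 : 5395 ≤ N) (h34 : (N : ℝ) < Real.exp 34)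
    (hlog : Real.log ((N : ℝ) - 2) ≤ 30) :
    (1 / 31 : ℝ) * (N : ℝ) ≤ (Nat.primeCounting (N - 2) : ℝ) := by
  have hcast : ((N - 2 : ℕ) : ℝ) = (N : ℝ) - 2 := by rw [Nat.cast_sub (by omega)]; norm_num
  have hN : (5395 : ℝ) ≤ N := by exact_mod_cast h1
  have h60 : ((N - 2 : ℕ) : ℝ) ≤ Real.exp 60 := by
    rw [hcast]; linarith [Real.exp_le_exp.mpr (show (34 : ℝ) ≤ 60 by norm_num)]
  have hx := le_primeCounting_of_le_exp60 (n := N - 2) (by omega) h60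
  have hlogpos : 0 < Real.log ((N : ℝ) - 2) := Real.log_pos (by linarith)
  rw [hcast, div_le_iff₀ hlogpos] at hx
  have hπ0 : (0 : ℝ) ≤ Nat.primeCounting (N - 2) := Nat.cast_nonneg _
  have : (Nat.primeCounting (N - 2) : ℝ) * Real.log ((N : ℝ) - 2) ≤ (Nat.primeCounting (N - 2) : ℝ) * 30 :=
    mul_le_mul_of_nonneg_left hlog hπ0
  linarith

/-- F2: `30 < log(N − 2) ≤ 31`: `N/31 ≤ π(N − 2)` from the regime `C = 1.003` on `[e^{30}, e^{31}]`
(`1.003 (N − 2) ≥ N` iff `N ≥ 669`). [folklore] -/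
private theorem range31_F2 {N : ℕ} (h1 : 5395 ≤ N) (hlo : 30 < Real.log ((N : ℝ) - 2))
    (hhi : Real.log ((N : ℝ) - 2) ≤ 31) :
    (1 / 31 : ℝ) * (N : ℝ) ≤ (Nat.primeCounting (N - 2) : ℝ) := by
  have hcast : ((N - 2 : ℕ) : ℝ) = (N : ℝ) - 2 := by rw [Nat.cast_sub (by omega)]; norm_num
  have hN : (5395 : ℝ) ≤ N := by exact_mod_cast h1
  have hpos : (0 : ℝ) < (N : ℝ) - 2 := by linarith
  have hx := le_primeCounting_floor_reg30 ((N : ℝ) - 2) (exp_le_of_le_log' hpos hlo.le) (le_exp_of_log_le' hpos hhi)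
  have hfl : ⌊(N : ℝ) - 2⌋₊ = N - 2 := by rw [← hcast, Nat.floor_natCast]
  have hlogpos : 0 < Real.log ((N : ℝ) - 2) := Real.log_pos (by linarith)
  rw [hfl, div_le_iff₀ hlogpos] at hx
  have hπ0 : (0 : ℝ) ≤ Nat.primeCounting (N - 2) := Nat.cast_nonneg _
  have : (Nat.primeCounting (N - 2) : ℝ) * Real.log ((N : ℝ) - 2) ≤ (Nat.primeCounting (N - 2) : ℝ) * 31 :=
    mul_le_mul_of_nonneg_left hhi hπ0
  linarith

/-- F3: `31 < log(N − 2) ≤ 31.2`: `N/31 ≤ π(N − 2)` from the regime `C = 1.008` on `[e^{31}, e^{31.2}]`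
(`31·1.008 (N − 2) ≥ 31.2 N` iff `N ≥ 1302`). [folklore] -/
private theorem range31_F3 {N : ℕ} (h1 : 5395 ≤ N) (hlo : 31 < Real.log ((N : ℝ) - 2))
    (hhi : Real.log ((N : ℝ) - 2) ≤ 31.2) :
    (1 / 31 : ℝ) * (N : ℝ) ≤ (Nat.primeCounting (N - 2) : ℝ) := by
  have hcast : ((N - 2 : ℕ) : ℝ) = (N : ℝ) - 2 := by rw [Nat.cast_sub (by omega)]; norm_num
  have hN : (5395 : ℝ) ≤ N := by exact_mod_cast h1
  have hpos : (0 : ℝ) < (N : ℝ) - 2 := by linarith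
  have hx := le_primeCounting_floor_reg31 ((N : ℝ) - 2) (exp_le_of_le_log' hpos hlo.le) (le_exp_of_log_le' hpos hhi)
  have hfl : ⌊(N : ℝ) - 2⌋₊ = N - 2 := by rw [← hcast, Nat.floor_natCast]
  have hlogpos : 0 < Real.log ((N : ℝ) - 2) := Real.log_pos (by linarith)
  rw [hfl, div_le_iff₀ hlogpos] at hx
  have hπ0 : (0 : ℝ) ≤ Nat.primeCounting (N - 2) := Nat.cast_nonneg _
  have : (Nat.primeCounting (N - 2) : ℝ) * Real.log ((N : ℝ) - 2) ≤ (Nat.primeCounting (N - 2) : ℝ) * 31.2 :=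
    mul_le_mul_of_nonneg_left hhi hπ0
  linarith

/-- F4: `31.2 < log(N − 2)`, `N < e^{34}`: `N/31 ≤ #romanovSet N` by two shifts.  (a) `N − 4 ≥ e^{32}`:
`2 (N − 4)/34 − 14.35 (N − 4)/1024 ≥ N/31` (`0.0448 ≥ 0.0323`); (b) `N − 4 < e^{32}`: the twin count is evaluated at
`⌈e^{32}⌉ ≤ 2.2256 (N − 2) + 1` (`log(N − 2) ≤ 31.5`: `2.006/31.5 − 0.03119 = 0.03249`) or `≤ 1.6487213 (N − 2) + 1`
(`log(N − 2) > 31.5`: `2.006/32 − 0.02311 = 0.03958`), with the junction constant `1.003` for `π(N − 4)`. [folklore] -/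
private theorem range31_F4 {N : ℕ} (h1 : 5395 ≤ N) (h34 : (N : ℝ) < Real.exp 34)
    (hlo : 31.2 < Real.log ((N : ℝ) - 2)) :
    (1 / 31 : ℝ) * (N : ℝ) ≤ ((romanovSet N).card : ℝ) := by
  have hcast2 : ((N - 2 : ℕ) : ℝ) = (N : ℝ) - 2 := by rw [Nat.cast_sub (by omega)]; norm_num
  have hcast4 : ((N - 4 : ℕ) : ℝ) = (N : ℝ) - 4 := by rw [Nat.cast_sub (by omega)]; norm_num
  have hN : (5395 : ℝ) ≤ N := by exact_mod_cast h1
  have hNpos : (0 : ℝ) < N := by linarith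
  have hpos2 : (0 : ℝ) < (N : ℝ) - 2 := by linarith
  have hpos4 : (0 : ℝ) < (N : ℝ) - 4 := by linarith
  have htwo := two_shifts_le (N := N) (by omega)
  have hmono : (Nat.primeCounting (N - 4) : ℝ) ≤ (Nat.primeCounting (N - 2) : ℝ) := by
    exact_mod_cast Nat.monotone_primeCounting (show N - 4 ≤ N - 2 by omega)
  have hπ0 : (0 : ℝ) ≤ Nat.primeCounting (N - 4) := Nat.cast_nonneg _
  have hlogN : Real.log (N : ℝ) < 34 := by
    have := Real.log_lt_log hNpos h34
    rwa [Real.log_exp] at this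
  have hlog4N : Real.log ((N : ℝ) - 4) ≤ Real.log (N : ℝ) := Real.log_le_log hpos4 (by linarith)
  have hlog42 : Real.log ((N : ℝ) - 4) ≤ Real.log ((N : ℝ) - 2) := Real.log_le_log hpos4 (by linarith)
  have hlogpos4 : 0 < Real.log ((N : ℝ) - 4) := Real.log_pos (by linarith)
  -- `e^{31.2} ≤ N − 2`, hence `e^{31} ≤ N − 4`
  have h312 : Real.exp 31.2 ≤ (N : ℝ) - 2 := exp_le_of_le_log' hpos2 hlo.le
  have h31 : Real.exp 31 ≤ (N : ℝ) - 4 := by linarith [exp_31_add_two_le]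
  have h60 : ((N - 4 : ℕ) : ℝ) ≤ Real.exp 60 := by
    rw [hcast4]; linarith [Real.exp_le_exp.mpr (show (34 : ℝ) ≤ 60 by norm_num)]
  by_cases ha : Real.exp 32 ≤ (N : ℝ) - 4
  · -- (a) the pair sieve at `N − 4` itself, `π(N − 4) ≥ (N − 4)/log(N − 4) ≥ (N − 4)/34`
    have hT := twinLE_le (x := N - 4) (by rw [hcast4]; exact ha)
    rw [hcast4] at hT
    have hx := le_primeCounting_of_le_exp60 (n := N - 4) (by omega) h60
    rw [hcast4, div_le_iff₀ hlogpos4] at hx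
    have : (Nat.primeCounting (N - 4) : ℝ) * Real.log ((N : ℝ) - 4) ≤ (Nat.primeCounting (N - 4) : ℝ) * 34 :=
      mul_le_mul_of_nonneg_left (by linarith) hπ0
    linarith
  · push Not at ha
    -- (b) the pair sieve at `X = ⌈e^32⌉`, junction constant for `π(N − 4)`
    set X : ℕ := ⌈Real.exp 32⌉₊ with hX
    have hXge : Real.exp 32 ≤ (X : ℝ) := Nat.le_ceil _
    have hXlt : (X : ℝ) < Real.exp 32 + 1 := Nat.ceil_lt_add_one (Real.exp_pos 32).le
    have hle : N - 4 ≤ X := by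
      have : ((N - 4 : ℕ) : ℝ) ≤ (X : ℝ) := by rw [hcast4]; linarith
      exact_mod_cast this
    have hTm : (twinLE (N - 4) : ℝ) ≤ (twinLE X : ℝ) := by exact_mod_cast twinLE_mono hle
    have hTX := twinLE_le (x := X) hXge
    have hx := le_primeCounting_floor_junction ((N : ℝ) - 4) h31 ha.le
    have hfl : ⌊(N : ℝ) - 4⌋₊ = N - 4 := by rw [← hcast4, Nat.floor_natCast]
    rw [hfl, div_le_iff₀ hlogpos4] at hx
    by_cases hb : Real.log ((N : ℝ) - 2) ≤ 31.5
    · have hE := (exp_32_le_mul (y := (N : ℝ) - 2)).1 h312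
      have : (Nat.primeCounting (N - 4) : ℝ) * Real.log ((N : ℝ) - 4) ≤ (Nat.primeCounting (N - 4) : ℝ) * 31.5 :=
        mul_le_mul_of_nonneg_left (hlog42.trans hb) hπ0
      linarith
    · push Not at hb
      have h315 : Real.exp 31.5 ≤ (N : ℝ) - 2 := exp_le_of_le_log' hpos2 hb.le
      have hE := (exp_32_le_mul (y := (N : ℝ) - 2)).2 h315
      have hlog4 : Real.log ((N : ℝ) - 4) ≤ 32 := by
        have := Real.log_lt_log hpos4 ha
        rw [Real.log_exp] at this
        exact this.le
      have : (Nat.primeCounting (N - 4) : ℝ) * Real.log ((N : ℝ) - 4) ≤ (Nat.primeCounting (N - 4) : ℝ) * 32 :=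
        mul_le_mul_of_nonneg_left hlog4 hπ0
      linarith

/-! ## §S5 The headline of part S -/

/-- ★★ **ROMANOFF'S THEOREM, EXPLICIT, UNIFORM IN `N`, UNCONDITIONAL, constant `1/31`**: for every `N ≥ 4`,
`#{n ≤ N : n = p + 2^k, p prime, k ≥ 1} ≥ N/31` — the all-`N` constant equals the tree's large-range constant
(`romanov_ge_div31`, `N ≥ e^{38}`).  Ranges: `N ≥ e^{34}` windowed engine / tree (§R3); `e^{31.2} < N − 2`, `N < e^{34}`
two shifts (§S4 F4); `(e^{30}, e^{31.2}]` one shift with the Abel regimes `1.003` / `1.008` (F2, F3); `log(N − 2) ≤ 30` one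
shift with `π(n) ≥ n/log n` (F1); `N < 5395` kernel checkpoints.  No named fact anywhere.
[cite: Nathanson1996, §7.6 Theorem 7.11 (Romanov's theorem) — explicit-uniform form with constant 1/31 proved here] -/
theorem romanoffAllN_31 : RomanoffAllN (1 / 31 : ℝ) 4 := by
  intro N hN
  by_cases h34 : Real.exp 34 ≤ (N : ℝ)
  · exact romanov_ge_div31_from_exp34 h34
  push Not at h34
  by_cases hF4 : 31.2 < Real.log ((N : ℝ) - 2) ∧ 5395 ≤ N
  · exact range31_F4 hF4.2 h34 hF4.1
  have hR : (Nat.primeCounting (N - 2) : ℝ) ≤ ((romanovSet N).card : ℝ) := by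
    exact_mod_cast primeCounting_le_card_romanovSet N
  refine le_trans ?_ hR
  by_cases h5 : N < 5395
  · exact small_range31 hN h5
  have h1 : 5395 ≤ N := by omega
  have hlo : Real.log ((N : ℝ) - 2) ≤ 31.2 := by
    by_contra hc; push Not at hc; exact hF4 ⟨hc, h1⟩
  by_cases h30 : Real.log ((N : ℝ) - 2) ≤ 30
  · exact range31_F1 h1 h34 h30
  by_cases h31 : Real.log ((N : ℝ) - 2) ≤ 31
  · exact range31_F2 h1 (by push Not at h30; exact h30) h31
  · exact range31_F3 h1 (by push Not at h31; exact h31) hlo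

/-- The same, unfolded: `∀ N ≥ 4, N/31 ≤ #romanovSet N`. [cite: Nathanson1996, §7.6 Theorem 7.11 (Romanov's theorem) —
explicit-uniform form with constant 1/31 proved here] -/
theorem romanoffAllN_31_statement :
    ∀ N : ℕ, 4 ≤ N → (1 / 31 : ℝ) * (N : ℝ) ≤ ((romanovSet N).card : ℝ) := romanoffAllN_31


/-! ## §S6 Bonus: the large range with the new `π`-inputs — `N/29` from `e^{38}` (tree: `N/31`) -/

/-- `2^38 ≤ e^{38}`. [folklore] -/
private theorem exp_38_ge : (274877906944 : ℝ) ≤ Real.exp 38 := by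
  have he : (2 : ℝ) ≤ Real.exp 1 := by have := Real.exp_one_gt_d9; linarith
  have h : (2 : ℝ) ^ 38 ≤ Real.exp 38 := by
    rw [show (38 : ℝ) = ((38 : ℕ) : ℝ) * 1 by norm_num, Real.exp_nat_mul]
    exact pow_le_pow_left₀ (by norm_num) he 38
  exact le_trans (by norm_num) h

/-- **`N ≥ e^{38}`: `#romanovSet N ≥ N/29`, unconditionally** (tree `romanov_ge_div31`: `N/31`).  On `[e^{38}, e^{60}]` the
windowed engine with `c₀ = 1`, `A = 13.01`, `s = 1.3897` (`0.035841 ≥ 1/28`); beyond `e^{60}` the tree's `density_mul_param`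
with the global `c₀ = 0.9844` of part A, `Λ = 60`, `s = 1.387` (`0.035703 ≥ 1/29`).
[cite: Nathanson1996, §7.6 Theorem 7.11 (Romanov's theorem) — explicit form with constant 1/29 from e^38 proved here] -/
theorem romanov_ge_div29_from_exp38 {N : ℕ} (h38 : Real.exp 38 ≤ (N : ℝ)) :
    (1 / 29 : ℝ) * (N : ℝ) ≤ ((romanovSet N).card : ℝ) := by
  have hN0 : (0 : ℝ) ≤ N := Nat.cast_nonneg N
  by_cases h60 : (N : ℝ) ≤ Real.exp 60
  · have hd := density_mul_window (A := 13.01) (x₀ := Real.exp 38) (c₀ := 1) (s := 1.3897) (Λ := 38)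
      (x₁ := 17) (by norm_num) uniformPairSieve_1301 (by norm_num) (by norm_num) (by norm_num) (by norm_num)
      (by push_cast; linarith [exp_38_ge]) (by push_cast; linarith [exp_38_ge])
      (fun L hL => by nlinarith) (window_hyp h60) h38 h38
    have hc : (1 / 29 : ℝ) ≤ (1.3897 : ℝ) ^ 2 / (1.3897 + 4.035 * 13.01) := by norm_num
    nlinarith
  · push Not at h60
    have h3860 : Real.exp 38 ≤ Real.exp 60 := Real.exp_le_exp.mpr (by norm_num)
    have hd := density_mul_param (A := 13.01) (x₀ := Real.exp 38) (c₀ := 0.9844) (s := 1.387) (Λ := 60)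
      (x₁ := 17) (by norm_num) uniformPairSieve_1301 (by norm_num) (by norm_num) primeCountingLowerMul_09844
      (by norm_num) (by norm_num) (by push_cast; linarith [exp_38_ge]) (by push_cast; linarith [exp_38_ge])
      (fun L hL => by nlinarith) (h3860.trans h60.le) h60.le
    have hc : (1 / 29 : ℝ) ≤ (1.387 : ℝ) ^ 2 / (1.387 + 4.035 * 13.01) := by norm_num
    nlinarith

end Literature.NumberTheory.Sieve.RomanoffExplicit
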